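import Literature.MathematicalPhysics.QuantumFieldTheory.Balaban1983to89.B9RWSums343to347Whole
import Literature.MathematicalPhysics.QuantumFieldTheory.Balaban1983to89.B9SectDL2Decay
import Literature.MathematicalPhysics.QuantumFieldTheory.Balaban1983to89.B9FromB6

/-!
# `Balaban1983to89.B9RWSums346Schur` — [B9] the L² members (3.46)₁,₂,₃ of the random walk sums (3.90) ∕ (3.107) from their
# sup majorants (3.42): the Schur test with the symmetry ∕ transpose letters of G, G′, ∇_U, ∇\*_U and p. 398's scale transfer

T. Bałaban, *Propagators for lattice gauge theories in a background field*, Commun. Math. Phys. **99** (1985) 389–434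
[`Balaban1985BackgroundPropagators`, "B9"]; [4] = T. Bałaban, *Propagators and renormalization transformations for lattice
gauge theories. II*, Commun. Math. Phys. **96** (1984) 223–250 [`Balaban1984PropagatorsII`].

statement-level skeleton of published theorems with citation tags; proofs where landed; nothing here is a claim about the
Yang–Mills mass gap

THE PRINTED LOCI (verbatim).  (3.46), p. 398: *"Finally, we have the inequalities in L²-norms ‖hG′(U)λ‖, ‖h∇_UG′(U)λ‖,
‖hG′(U)∇\*_Uλ‖, ‖hΔ_UG′(U)λ‖, … ≦ B₀[(L^jη)², L^jη, L^jη, 1, 1, 1]|h|e^{−δ₀d(y,y′)}‖λ‖ for supp h ⊂ Δ(y), y ∈ Λ_j,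
supp λ ⊂ Δ(y′); (3.46)"*; p. 398: *"At first the choice of derivatives ∇_U, ∇\*_U is conventional, we may always replace ∇_U by
∇\*_U, and vice versa, in arbitrary place and combination. Next, the choice of powers L^jη is conventional also. Using Lemma 2.1 in
[4] we may replace the factor (L^jη)^α by (L^jη)^β(L^{j′}η)^γ with β + γ = α"*; p. 391: *"The adjoints are taken with respect to
natural L² scalar products"*; p. 416 (Theorem 3.11): *"the operators Δ′_a, G′, (Q′G′²Q′\*)⁻¹, Δ_a, G are positive definite … It
is a symmetric and invertible operator"*; Theorem 3.7 p. 409 ∕ Theorem 3.10 p. 416: *"convergent in all norms appearing in the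
inequalities (3.42)–(3.47)"*.

THE POINT.  The sibling `B9RWSums343to347Whole` types the summation leaf `B9.RWSumsYieldIneqs` at the ALL-BLOCKS pins and PROVES,
inside the leaves `B9.Thm37Printed` ∕ `B9.Thm310Printed` under their provisos, the (3.42) clauses and the (3.47) lines of both sums
from the four sup majorants (`Conv342` ∕ `Conv3107`); the L² lines (3.46) stayed DISPLAYED.  THIS FILE proves the first three of
them — ‖hGJ‖, ‖h∇_UGJ‖, ‖hG∇\*_UJ‖ — from the SAME sup majorants, by the route seat `pub-ymgap-dag-n06-d` located on the bus
(INTERFACE-2: *"(3.46) ⇐ sup majorants needs a Schur-type step + a symmetry∕transpose letter"*):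

* §1 **the Schur test for lattice operators between two block structures** (`bsq_mulVec_le_of_blkMaj`, `blockBd_schur`): block
  row sums of |T| (r1's `B9SectCDiffEstimate.BlkMaj`, obtained from a [4]-(2.51) majorant by n06-c's `blkMaj_of_hasMajorantHom`)
  and block row sums of the TRANSPOSE (from a majorant of Tᵀ, `B9Thm37Glue.IsTransposePair`) give r1's L² block bound
  `B9SectDL2Decay.BlockBd blk₁ blk₂ T (√(K(y,y′)K′(y′,y)))` — Cauchy–Schwarz.
* §2 **the scale transfer** of p. 398 for the weights (L^jη)^γ, γ = 1, ½ (`scaleTransfer_len_rpow`, by `B9Ineq347.scaleTransfer_of_260`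
  under the member facts `B9RWSums343to347Whole.Facts347`), and the three entries: G symmetric (`IsTransposePair A₀ A₀`) and
  (∇_UG)ᵀ = G∇\*_U (`IsTransposePair A₁ A₂`; from ∇\*_U = ∇_Uᵀ and Gᵀ = G by `IsTransposePair.comp`) ⇒ `blockBd_entry0∕1∕2`: the
  L² block bounds C·L₀·[(L^jη)², L^jη, L^jη]·e^{−(1−α)δd(y,y′)}.
* §3 `L2Reads` — the co-reading of the L² quantities `K.l2 n` of a kernel family by a model operator (‖h·T(ev J)‖ on Δ(y) against
  |h|·‖1_{Δ(y)}T(ev J)‖₂; ‖1_{Δ(y′)}ev J‖₂ ≦ ‖J‖), and `l2line_of_blockBd`: an L² block bound of the printed shape gives the n-th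
  (3.46) line AS TYPED.
* §4 `l2lines012_of_majorants` — ONE member, ONE U: the (3.46) lines n = 0, 1, 2 for a co-read kernel family from the three sup
  majorants, the two transpose letters, the member facts and the sign facts (d symmetric, ≧ 0; L^jη > 0).
* §5 ★ `thm310Printed_allPin_schur` ∕ ★ `thm37Printed_allPin_schur` — the sibling's all-blocks leaves with the displayed residual
  SHRUNK to (3.43)–(3.45) and the lines n = 3, 4, 5 of (3.46) (Δ_UG and the two one-sided differences: (Δ_UG)ᵀ = GΔ_U has no sup
  majorant among the four, so the Schur route does not reach them).

HONEST SCOPE.  Nothing of print is asserted.  The symmetry ∕ transpose letters (`IsTransposePair (G U) (G U)`, `IsTransposePair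
(D U) (Dstar U)` — true for Bałaban's self-adjoint G, G′ and the L² adjoint ∇\*_U of p. 391 ∕ Theorem 3.11, but hypotheses on the
abstract letters here), the readings `L2Reads`, the member facts ((2.60), L ≧ 1, the size condition) are HYPOTHESES of printed
shape; (3.46)₄,₅,₆ and the Hölder members stay displayed.  Value: kernel-checked bookkeeping shrinking a located residual; NOT a
node discharge, NOT summit progress; one finite lattice paper; nothing continuum, nothing about the mass gap.  Cell `pub-ymgap`
(HUMAN RULING D-0062), Track A node N06 [B9], seat `pub-ymgap-dag-n06-k` (N06-ASSIGNMENT v1 rows 18–19), 2026-08-26.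
-/

namespace Literature.MathematicalPhysics.QuantumFieldTheory.Balaban1983to89.B9RWSums346Schur

open Literature.MathematicalPhysics.QuantumFieldTheory.Balaban1983to89
open Finset B6RandomWalk B6RandomWalkHom B9Thm34Ext B9Thm37Whole B9Cor38Whole B9Thm310Whole B9RWSums343to347Whole
open B9Thm37GlueCor36 B9SectCDiffEstimate B9SectCDiffDict B9SectDL2Decay B9Ineq347 B9Ineq347AllEntries
open B9Thm37Glue

noncomputable section

/-! ## §1 The Schur test for lattice operators between two block structures -/

section Schur

variable {G : B6.Geometry} {X₁ X₂ : Type} [Fintype X₁] [Fintype X₂]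

omit [Fintype X₁] in
/-- Weighted Cauchy–Schwarz: (Σ_j a_j b_j)² ≦ (Σ_j |a_j|)·(Σ_j |a_j| b_j²). [folklore] -/
private theorem sq_sum_mul_le (s : Finset X₁) (a b : X₁ → ℝ) :
    (∑ j ∈ s, a j * b j) ^ 2 ≤ (∑ j ∈ s, |a j|) * (∑ j ∈ s, |a j| * b j ^ 2) :=
  Finset.sum_sq_le_sum_mul_sum_of_sq_le_mul s (fun j _ => abs_nonneg (a j))
    (fun j _ => mul_nonneg (abs_nonneg (a j)) (sq_nonneg (b j))) fun j _ => by
      rw [mul_pow, ← mul_assoc, ← sq_abs (a j), sq]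

/-- The block-L² size squared as a sum over the block (the sibling's `bsq` unfolded with a `Finset.filter`). [folklore] -/
private theorem bsq_eq_sum_filter [DecidableEq G.Site] {X : Type} [Fintype X] (blk : X → G.Site) (y : G.Site)
    (f : X → ℝ) : bsq blk y f = ∑ x ∈ Finset.univ.filter (fun x => blk x = y), f x ^ 2 := by
  rw [Finset.sum_filter]
  unfold bsq
  exact Finset.sum_congr rfl fun x _ => by split_ifs <;> rfl

/-- **THE SCHUR TEST, MATRIX FORM** (Cauchy–Schwarz): a real matrix M : X₂ × X₁ whose rows have the block sums
Σ_{x′∈Δ(y′)}|M(x,x′)| ≦ K(y,y′) (x ∈ Δ(y); r1's `BlkMaj blk₂ blk₁ M K`) and whose COLUMNS have the block sums Σ_{x∈Δ(y)}|M(x,x′)| ≦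
K′(y′,y) (x′ ∈ Δ(y′); `BlkMaj blk₁ blk₂ Mᵀ K′`) maps a vector supported in Δ(y′) with ‖1_{Δ(y)}Mμ‖₂² ≦ K(y,y′)K′(y′,y)‖1_{Δ(y′)}μ‖₂²
— Schur's test, the step behind print's *"Finally, we have the inequalities in L²-norms … (3.46)"* for operators given by their
sup (row) bounds and their adjoints' (p. 391). [cite: Balaban1985BackgroundPropagators, (3.46) p.398 + p.391 (the L² adjoints); Schur's test, folklore] -/
theorem bsq_mulVec_le_of_blkMaj [DecidableEq G.Site] (blk₁ : X₁ → G.Site) (blk₂ : X₂ → G.Site) {M : Matrix X₂ X₁ ℝ}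
    {K K' : G.Site → G.Site → ℝ} (hrow : BlkMaj blk₂ blk₁ M K) (hcol : BlkMaj blk₁ blk₂ M.transpose K')
    {y' : G.Site} {μ : X₁ → ℝ} (hμ : ∀ x, blk₁ x ≠ y' → μ x = 0) (y : G.Site) :
    bsq blk₂ y (M.mulVec μ) ≤ K y y' * K' y' y * bsq blk₁ y' μ := by
  set S : Finset X₁ := Finset.univ.filter (fun x' => blk₁ x' = y') with hS
  set T : Finset X₂ := Finset.univ.filter (fun x => blk₂ x = y) with hT
  -- (Mμ)(x) = Σ_{x′∈Δ(y′)} M(x,x′)μ(x′)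
  have hmv : ∀ x, M.mulVec μ x = ∑ x' ∈ S, M x x' * μ x' := by
    intro x
    rw [Matrix.mulVec, dotProduct, ← Finset.sum_filter_add_sum_filter_not Finset.univ (fun x' => blk₁ x' = y')]
    have hz : ∑ x' ∈ Finset.univ.filter (fun x' => ¬ blk₁ x' = y'), M x x' * μ x' = 0 :=
      Finset.sum_eq_zero fun x' hx' => by rw [hμ x' (Finset.mem_filter.mp hx').2, mul_zero]
    rw [hz, add_zero]
  -- one row: Cauchy–Schwarz and the row block sum
  have hx : ∀ x ∈ T, (M.mulVec μ x) ^ 2 ≤ K y y' * ∑ x' ∈ S, |M x x'| * μ x' ^ 2 := by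
    intro x hxT
    have hxy : blk₂ x = y := (Finset.mem_filter.mp hxT).2
    rw [hmv x]
    refine (sq_sum_mul_le S (fun x' => M x x') μ).trans ?_
    have hr : ∑ x' ∈ S, |M x x'| ≤ K y y' := by rw [← hxy]; exact hrow.le x y'
    exact mul_le_mul_of_nonneg_right hr (Finset.sum_nonneg fun j _ => mul_nonneg (abs_nonneg _) (sq_nonneg _))
  -- one column: the block sum of the transpose
  have hc : ∀ x' ∈ S, ∑ x ∈ T, |M x x'| ≤ K' y' y := by
    intro x' hx'
    have e : blk₁ x' = y' := (Finset.mem_filter.mp hx').2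
    have h := hcol.le x' y
    rw [e] at h
    simpa only [Matrix.transpose_apply] using h
  rw [bsq_eq_sum_filter blk₂ y, bsq_eq_sum_filter blk₁ y']
  calc ∑ x ∈ T, M.mulVec μ x ^ 2
      ≤ ∑ x ∈ T, K y y' * ∑ x' ∈ S, |M x x'| * μ x' ^ 2 := Finset.sum_le_sum hx
    _ = K y y' * ∑ x' ∈ S, (∑ x ∈ T, |M x x'|) * μ x' ^ 2 := by
        rw [← Finset.mul_sum, Finset.sum_comm]
        congr 1
        exact Finset.sum_congr rfl fun x' _ => by rw [Finset.sum_mul]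
    _ ≤ K y y' * ∑ x' ∈ S, K' y' y * μ x' ^ 2 :=
        mul_le_mul_of_nonneg_left (Finset.sum_le_sum fun x' hx' => mul_le_mul_of_nonneg_right (hc x' hx') (sq_nonneg _))
          (hrow.nonneg _ _)
    _ = K y y' * K' y' y * ∑ x' ∈ S, μ x' ^ 2 := by rw [← Finset.mul_sum]; ring

/-- **THE SCHUR TEST, OPERATOR FORM.**  A linear T : (X₁ → ℝ) → (X₂ → ℝ) with the [4]-(2.51) majorant K ≧ 0 between the block
structures `blk₁`, `blk₂` (*"|(Tμ)(x)| ≦ K(y,y′)|μ| for x ∈ Δ(y), supp μ ⊂ Δ(y′)"* — the row block sums), whose TRANSPOSE T′ for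
the component pairing (`IsTransposePair T T′`; print: the L² adjoint, p. 391) has the majorant K′ ≧ 0 (the column block sums), has
r1's L² block bound `BlockBd blk₁ blk₂ T (√(K(y,y′)K′(y′,y)))`: ‖1_{Δ(y)}Tμ‖₂ ≦ √(K(y,y′)K′(y′,y))‖μ‖₂ for supp μ ⊂ Δ(y′) — the
passage from the sup entries (3.42) and their transposes (p. 398: *"we may always replace ∇_U by ∇\*_U, and vice versa"*) to the
L² entries (3.46) of the same operators. [cite: Balaban1985BackgroundPropagators, (3.46) p.398 + (3.42) p.397 + p.391 (the L² adjoints); Schur's test, folklore] -/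
theorem blockBd_schur (blk₁ : X₁ → G.Site) (blk₂ : X₂ → G.Site)
    {T : (X₁ → ℝ) →ₗ[ℝ] (X₂ → ℝ)} {T' : (X₂ → ℝ) →ₗ[ℝ] (X₁ → ℝ)} {K K' : G.Site → G.Site → ℝ}
    (hK : ∀ a b, 0 ≤ K a b) (hK' : ∀ a b, 0 ≤ K' a b) (hT : HasMajorantHom blk₁ blk₂ T K)
    (hT' : HasMajorantHom blk₂ blk₁ T' K') (hadj : IsTransposePair T T') :
    BlockBd blk₁ blk₂ T (fun y y' => Real.sqrt (K y y' * K' y' y)) := by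
  classical
  intro y' μ hμ y
  have hrow : BlkMaj blk₂ blk₁ (LinearMap.toMatrix' T) K := blkMaj_of_hasMajorantHom hK hT
  have hcol' : BlkMaj blk₁ blk₂ (LinearMap.toMatrix' T') K' := blkMaj_of_hasMajorantHom hK' hT'
  have htr : (LinearMap.toMatrix' T).transpose = LinearMap.toMatrix' T' := by
    ext x' x
    rw [Matrix.transpose_apply, LinearMap.toMatrix'_apply, LinearMap.toMatrix'_apply]
    have h := hadj (Pi.single x' 1) (Pi.single x 1)
    have h1 : ∑ y, T (Pi.single x' 1) y * Pi.single (M := fun _ : X₂ => ℝ) x (1 : ℝ) y = T (Pi.single x' 1) x := by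
      rw [Fintype.sum_eq_single x (fun y hy => by rw [Pi.single_eq_of_ne hy, mul_zero]), Pi.single_eq_same, mul_one]
    have h2 : ∑ x'', Pi.single (M := fun _ : X₁ => ℝ) x' (1 : ℝ) x'' * T' (Pi.single x 1) x'' = T' (Pi.single x 1) x' := by
      rw [Fintype.sum_eq_single x' (fun y hy => by rw [Pi.single_eq_of_ne hy, zero_mul]), Pi.single_eq_same, one_mul]
    rw [← h1, ← h2]
    exact h
  have hcol : BlkMaj blk₁ blk₂ (LinearMap.toMatrix' T).transpose K' := by rw [htr]; exact hcol'
  have hmv : (LinearMap.toMatrix' T).mulVec μ = T μ := LinearMap.toMatrix'_mulVec T μ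
  have h := bsq_mulVec_le_of_blkMaj blk₁ blk₂ hrow hcol hμ y
  rw [hmv] at h
  have hKK : 0 ≤ K y y' * K' y' y := mul_nonneg (hK _ _) (hK' _ _)
  calc bl2 blk₂ y (T μ) = Real.sqrt (bsq blk₂ y (T μ)) := rfl
    _ ≤ Real.sqrt (K y y' * K' y' y * bsq blk₁ y' μ) := Real.sqrt_le_sqrt h
    _ = Real.sqrt (K y y' * K' y' y) * bl2 blk₁ y' μ := by rw [Real.sqrt_mul hKK]; rfl

end Schur

/-! ## §2 The scale transfer for the weights (L^jη)^γ and the three L² block bounds -/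

section Entries

variable {g : B9.Geometry} [Fintype g.Site] {R : ℝ} {H : Prop}
variable {X Y : Type} [Fintype X] [Fintype Y]

/-- **p. 398's scale transfer for the weight (L^jη)^γ, |γ| ≦ 4, under the member facts**: e^{−αδd(y,y′)}(L^{j′}η)^γ ≦
L^{|γ|}(L^jη)^γ (`B9Ineq347.ScaleTransfer`), from [4] (2.60) at the exponent α and the size condition 4·log L ≦ αδRM
(`B9Ineq347.scaleTransfer_of_260`, exactly as inside `B9Ineq347AllEntries.glob347_of_342_weighted`).
[cite: Balaban1985BackgroundPropagators, p.398 remark after (3.47); Balaban1984PropagatorsII, Lemma 2.1 (2.60) p.234] -/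
theorem scaleTransfer_len_rpow {d : ℕ} {δ α L₀ : ℝ} (hF : Facts347 g R H d δ α L₀) (γ : ℝ) (hγ : |γ| ≤ 4) :
    ScaleTransfer g δ α (g.L ^ |γ|) (fun y => g.len y ^ γ) := by
  have hL0 : 0 < g.L := lt_of_lt_of_le one_pos hF.one_le_L
  obtain ⟨hsz, -⟩ := size_condition_compact g.L γ _ hF.one_le_L hγ hF.size
  exact scaleTransfer_of_260 g δ α (Real.exp (-(α * δ * R * g.M))) (g.L ^ |γ|) (fun y => g.len y ^ γ)
    (fun y y' => Nat.dist (g.scale y) (g.scale y')) (Real.exp_nonneg _) (Real.one_le_rpow hF.one_le_L (abs_nonneg γ))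
    (rpow_abs_mul_exp_le_one g.L γ _ hL0 hsz) (weight_nonneg g hL0 hF.eta_pos γ)
    (h260_nat_of_Ineq260 g R H δ α hF.h260) (fun y y' => weight_ratio g hF.one_le_L hF.eta_pos γ y y')

/-- The transfer read as a bound on the mixed weight: (L^jη)^a(L^{j′}η)^γ e^{−δd} ≦ L^{|γ|}(L^jη)^{a}(L^jη)^γ e^{−(1−α)δd}.
[cite: Balaban1985BackgroundPropagators, p.398 remark after (3.47)] -/
private theorem mixed_weight_le {d : ℕ} {δ α L₀ : ℝ} (hF : Facts347 g R H d δ α L₀) (γ : ℝ) (hγ : |γ| ≤ 4) {A : ℝ}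
    (hA : 0 ≤ A) (y y' : g.Site) :
    A * g.len y' ^ γ * Real.exp (-(δ * g.dist y y')) ≤
      A * (g.L ^ |γ| * g.len y ^ γ) * Real.exp (-((1 - α) * δ * g.dist y y')) := by
  have hst := scaleTransfer_len_rpow hF γ hγ y y'
  have hsplit : Real.exp (-(δ * g.dist y y')) =
      Real.exp (-(α * δ * g.dist y y')) * Real.exp (-((1 - α) * δ * g.dist y y')) := by
    rw [← Real.exp_add]; congr 1; ring
  rw [hsplit]
  calc A * g.len y' ^ γ * (Real.exp (-(α * δ * g.dist y y')) * Real.exp (-((1 - α) * δ * g.dist y y')))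
      = A * (Real.exp (-(α * δ * g.dist y y')) * g.len y' ^ γ) * Real.exp (-((1 - α) * δ * g.dist y y')) := by ring
    _ ≤ A * (g.L ^ |γ| * g.len y ^ γ) * Real.exp (-((1 - α) * δ * g.dist y y')) :=
        mul_le_mul_of_nonneg_right (mul_le_mul_of_nonneg_left hst hA) (Real.exp_nonneg _)

/-- L^{|γ|} ≦ L₀ for |γ| ≦ 1 and 1 ≦ L ≦ L₀. [folklore] -/
private theorem rpow_abs_le_L₀ {d : ℕ} {δ α L₀ : ℝ} (hF : Facts347 g R H d δ α L₀) (γ : ℝ) (hγ : |γ| ≤ 1) :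
    g.L ^ |γ| ≤ L₀ :=
  calc g.L ^ |γ| ≤ g.L ^ (1 : ℝ) := Real.rpow_le_rpow_of_exponent_le hF.one_le_L hγ
    _ = g.L := Real.rpow_one _
    _ ≤ L₀ := hF.L_le

/-- **(3.46)₁ as an L² block bound from (3.42)₁ and the symmetry of G**: if A₀ = G(U) has the sup majorant C(L^jη)²e^{−δd} and
is SYMMETRIC for the component pairing (Theorem 3.11: *"It is a symmetric and invertible operator"*), then by the Schur test
(row bound at y, column bound = row bound at y′) ‖1_{Δ(y)}A₀μ‖₂ ≦ C·L^jη·L^{j′}η·e^{−δd}‖μ‖₂, and by the scale transfer (γ = 1)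
‖1_{Δ(y)}A₀μ‖₂ ≦ C L₀(L^jη)²e^{−(1−α)δd(y,y′)}‖μ‖₂ for supp μ ⊂ Δ(y′) — r1's `BlockBd`. [cite: Balaban1985BackgroundPropagators, (3.46) p.398 + (3.42) p.397 + Thm 3.11 p.416] -/
theorem blockBd_entry0 {d : ℕ} {δ α L₀ C : ℝ} (hF : Facts347 g R H d δ α L₀) (hC : 0 ≤ C)
    (hsymm : ∀ y y' : g.Site, g.dist y y' = g.dist y' y) (hlen : ∀ y : g.Site, 0 < g.len y) (blk : X → g.Site)
    {A0 : Module.End ℝ (X → ℝ)}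
    (h0 : HasMajorant (g := toB6 g R H) blk A0 (fun (a b : g.Site) => C * g.len a ^ 2 * Real.exp (-(δ * g.dist a b))))
    (hsym : IsTransposePair A0 A0) :
    BlockBd (g := toB6 g R H) blk blk A0
      (fun (y y' : g.Site) => C * L₀ * g.len y ^ 2 * Real.exp (-((1 - α) * δ * g.dist y y'))) := by
  have hK : ∀ a b : g.Site, 0 ≤ C * g.len a ^ 2 * Real.exp (-(δ * g.dist a b)) := fun a b =>
    mul_nonneg (mul_nonneg hC (sq_nonneg _)) (Real.exp_nonneg _)
  have h0' : HasMajorantHom (g := toB6 g R H) blk blk A0 (fun (a b : g.Site) => C * g.len a ^ 2 * Real.exp (-(δ * g.dist a b))) :=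
    (hasMajorantHom_iff (g := toB6 g R H) blk A0 _).mpr h0
  have hS := blockBd_schur (G := toB6 g R H) blk blk hK hK h0' h0' hsym
  refine hS.mono fun y y' => ?_
  have hlen0 : ∀ z : g.Site, 0 ≤ g.len z := fun z => (hlen z).le
  -- √(C(L^jη)²e^{−δd} · C(L^{j′}η)²e^{−δd}) = C·L^jη·L^{j′}η·e^{−δd}
  have hsq : (C * g.len y ^ 2 * Real.exp (-(δ * g.dist y y'))) * (C * g.len y' ^ 2 * Real.exp (-(δ * g.dist y' y))) =
      (C * g.len y * g.len y' * Real.exp (-(δ * g.dist y y'))) ^ 2 := by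
    rw [hsymm y' y]; ring
  have hnn : 0 ≤ C * g.len y * g.len y' * Real.exp (-(δ * g.dist y y')) :=
    mul_nonneg (mul_nonneg (mul_nonneg hC (hlen0 y)) (hlen0 y')) (Real.exp_nonneg _)
  show Real.sqrt ((C * g.len y ^ 2 * Real.exp (-(δ * g.dist y y'))) * (C * g.len y' ^ 2 * Real.exp (-(δ * g.dist y' y)))) ≤
    C * L₀ * g.len y ^ 2 * Real.exp (-((1 - α) * δ * g.dist y y'))
  rw [hsq, Real.sqrt_sq hnn]
  -- transfer γ = 1: L^{j′}η e^{−δd} ≤ L·L^jη·e^{−(1−α)δd}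
  have ht := mixed_weight_le hF 1 (by norm_num) (mul_nonneg hC (hlen0 y)) y y'
  simp only [Real.rpow_one] at ht
  have hL1 : g.L ^ |(1 : ℝ)| ≤ L₀ := rpow_abs_le_L₀ hF 1 (by norm_num)
  calc C * g.len y * g.len y' * Real.exp (-(δ * g.dist y y'))
      ≤ C * g.len y * (g.L ^ |(1 : ℝ)| * g.len y) * Real.exp (-((1 - α) * δ * g.dist y y')) := ht
    _ = g.L ^ |(1 : ℝ)| * (C * g.len y ^ 2 * Real.exp (-((1 - α) * δ * g.dist y y'))) := by ring
    _ ≤ L₀ * (C * g.len y ^ 2 * Real.exp (-((1 - α) * δ * g.dist y y'))) :=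
        mul_le_mul_of_nonneg_right hL1 (mul_nonneg (mul_nonneg hC (sq_nonneg _)) (Real.exp_nonneg _))
    _ = C * L₀ * g.len y ^ 2 * Real.exp (-((1 - α) * δ * g.dist y y')) := by ring

/-- The common computation of the two mixed entries: √(C·L^jη·e^{−δd(y,y′)} · C·L^{j′}η·e^{−δd(y′,y)}) followed by the transfer at
γ = ½ is ≦ C L₀ L^jη e^{−(1−α)δd(y,y′)}. [cite: Balaban1985BackgroundPropagators, p.398 remark after (3.47)] -/
private theorem sqrt_mixed_le {d : ℕ} {δ α L₀ C : ℝ} (hF : Facts347 g R H d δ α L₀) (hC : 0 ≤ C)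
    (hsymm : ∀ y y' : g.Site, g.dist y y' = g.dist y' y) (hlen : ∀ y : g.Site, 0 < g.len y) (y y' : g.Site) :
    Real.sqrt ((C * g.len y * Real.exp (-(δ * g.dist y y'))) * (C * g.len y' * Real.exp (-(δ * g.dist y' y)))) ≤
      C * L₀ * g.len y * Real.exp (-((1 - α) * δ * g.dist y y')) := by
  have hlen0 : ∀ z : g.Site, 0 ≤ g.len z := fun z => (hlen z).le
  have hhalf : ∀ z : g.Site, g.len z = (g.len z ^ (1 / 2 : ℝ)) ^ 2 := fun z => by
    rw [← Real.rpow_natCast, ← Real.rpow_mul (hlen0 z)]; norm_num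
  have hsq : (C * g.len y * Real.exp (-(δ * g.dist y y'))) * (C * g.len y' * Real.exp (-(δ * g.dist y' y))) =
      (C * g.len y ^ (1 / 2 : ℝ) * g.len y' ^ (1 / 2 : ℝ) * Real.exp (-(δ * g.dist y y'))) ^ 2 := by
    rw [hsymm y' y]
    conv_lhs => rw [hhalf y, hhalf y']
    ring
  have hnn : 0 ≤ C * g.len y ^ (1 / 2 : ℝ) * g.len y' ^ (1 / 2 : ℝ) * Real.exp (-(δ * g.dist y y')) :=
    mul_nonneg (mul_nonneg (mul_nonneg hC (Real.rpow_nonneg (hlen0 y) _)) (Real.rpow_nonneg (hlen0 y') _))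
      (Real.exp_nonneg _)
  rw [hsq, Real.sqrt_sq hnn]
  have ht := mixed_weight_le hF (1 / 2 : ℝ) (by rw [abs_of_nonneg (by norm_num : (0 : ℝ) ≤ 1 / 2)]; norm_num)
    (mul_nonneg hC (Real.rpow_nonneg (hlen0 y) (1 / 2 : ℝ))) y y'
  have hLh : g.L ^ |(1 / 2 : ℝ)| ≤ L₀ := rpow_abs_le_L₀ hF (1 / 2) (by rw [abs_of_nonneg (by norm_num : (0 : ℝ) ≤ 1 / 2)]; norm_num)
  have hyy : g.len y ^ (1 / 2 : ℝ) * g.len y ^ (1 / 2 : ℝ) = g.len y := by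
    rw [← sq]; exact (hhalf y).symm
  calc C * g.len y ^ (1 / 2 : ℝ) * g.len y' ^ (1 / 2 : ℝ) * Real.exp (-(δ * g.dist y y'))
      ≤ C * g.len y ^ (1 / 2 : ℝ) * (g.L ^ |(1 / 2 : ℝ)| * g.len y ^ (1 / 2 : ℝ)) *
          Real.exp (-((1 - α) * δ * g.dist y y')) := ht
    _ = g.L ^ |(1 / 2 : ℝ)| * (C * (g.len y ^ (1 / 2 : ℝ) * g.len y ^ (1 / 2 : ℝ)) *
          Real.exp (-((1 - α) * δ * g.dist y y'))) := by ring
    _ ≤ L₀ * (C * (g.len y ^ (1 / 2 : ℝ) * g.len y ^ (1 / 2 : ℝ)) * Real.exp (-((1 - α) * δ * g.dist y y'))) :=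
        mul_le_mul_of_nonneg_right hLh (mul_nonneg (mul_nonneg hC (mul_nonneg (Real.rpow_nonneg (hlen0 y) _)
          (Real.rpow_nonneg (hlen0 y) _))) (Real.exp_nonneg _))
    _ = C * L₀ * g.len y * Real.exp (-((1 - α) * δ * g.dist y y')) := by rw [hyy]; ring

/-- **(3.46)₂ as an L² block bound from (3.42)₂,₃ and (∇_UG)ᵀ = G∇\*_U**: A₁ = ∇_UG(U) : (X → ℝ) → (Y → ℝ) with sup majorant
CL^jηe^{−δd} and its transpose A₂ = G(U)∇\*_U (`IsTransposePair A₁ A₂`; p. 398: *"we may always replace ∇_U by ∇\*_U, and vice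
versa"*, p. 391: the L² adjoints) with the same majorant give, by the Schur test and the transfer at γ = ½, ‖1_{Δ(y)}A₁μ‖₂ ≦
C L₀ L^jη e^{−(1−α)δd(y,y′)}‖μ‖₂ for supp μ ⊂ Δ(y′). [cite: Balaban1985BackgroundPropagators, (3.46) p.398 + (3.42) p.397 + p.391] -/
theorem blockBd_entry1 {d : ℕ} {δ α L₀ C : ℝ} (hF : Facts347 g R H d δ α L₀) (hC : 0 ≤ C)
    (hsymm : ∀ y y' : g.Site, g.dist y y' = g.dist y' y) (hlen : ∀ y : g.Site, 0 < g.len y) (blk : X → g.Site)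
    (blkY : Y → g.Site) {A1 : (X → ℝ) →ₗ[ℝ] (Y → ℝ)} {A2 : (Y → ℝ) →ₗ[ℝ] (X → ℝ)}
    (h1 : HasMajorantHom (g := toB6 g R H) blk blkY A1 (fun (a b : g.Site) => C * g.len a * Real.exp (-(δ * g.dist a b))))
    (h2 : HasMajorantHom (g := toB6 g R H) blkY blk A2 (fun (a b : g.Site) => C * g.len a * Real.exp (-(δ * g.dist a b))))
    (htr : IsTransposePair A1 A2) :
    BlockBd (g := toB6 g R H) blk blkY A1
      (fun (y y' : g.Site) => C * L₀ * g.len y * Real.exp (-((1 - α) * δ * g.dist y y'))) := by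
  have hK : ∀ a b : g.Site, 0 ≤ C * g.len a * Real.exp (-(δ * g.dist a b)) := fun a b =>
    mul_nonneg (mul_nonneg hC (hlen a).le) (Real.exp_nonneg _)
  exact (blockBd_schur (G := toB6 g R H) blk blkY hK hK h1 h2 htr).mono fun y y' => sqrt_mixed_le hF hC hsymm hlen y y'

/-- **(3.46)₃ as an L² block bound**, the transposed twin: ‖1_{Δ(y)}G∇\*_Uμ‖₂ ≦ C L₀ L^jη e^{−(1−α)δd(y,y′)}‖μ‖₂ for supp μ ⊂ Δ(y′)
(μ on the lattice `Y`). [cite: Balaban1985BackgroundPropagators, (3.46) p.398 + (3.42) p.397 + p.391] -/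
theorem blockBd_entry2 {d : ℕ} {δ α L₀ C : ℝ} (hF : Facts347 g R H d δ α L₀) (hC : 0 ≤ C)
    (hsymm : ∀ y y' : g.Site, g.dist y y' = g.dist y' y) (hlen : ∀ y : g.Site, 0 < g.len y) (blk : X → g.Site)
    (blkY : Y → g.Site) {A1 : (X → ℝ) →ₗ[ℝ] (Y → ℝ)} {A2 : (Y → ℝ) →ₗ[ℝ] (X → ℝ)}
    (h1 : HasMajorantHom (g := toB6 g R H) blk blkY A1 (fun (a b : g.Site) => C * g.len a * Real.exp (-(δ * g.dist a b))))
    (h2 : HasMajorantHom (g := toB6 g R H) blkY blk A2 (fun (a b : g.Site) => C * g.len a * Real.exp (-(δ * g.dist a b))))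
    (htr : IsTransposePair A1 A2) :
    BlockBd (g := toB6 g R H) blkY blk A2
      (fun (y y' : g.Site) => C * L₀ * g.len y * Real.exp (-((1 - α) * δ * g.dist y y'))) := by
  have hK : ∀ a b : g.Site, 0 ≤ C * g.len a * Real.exp (-(δ * g.dist a b)) := fun a b =>
    mul_nonneg (mul_nonneg hC (hlen a).le) (Real.exp_nonneg _)
  exact (blockBd_schur (G := toB6 g R H) blkY blk hK hK h2 h1 htr.symm).mono fun y y' => sqrt_mixed_le hF hC hsymm hlen y y'

end Entries

/-! ## §3 The L² co-reading of a kernel family and the (3.46) lines as typed -/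

section Reading

variable {g : B9.Geometry} [Fintype g.Site] {R : ℝ} {H : Prop} {B : B9.Backgrounds} {u v : Type} [Fintype u] [Fintype v]

/-- **CO-READING of the n-th L² quantity (3.46) of a kernel family by a model operator** (companion of `CoRealizes` and
`GlobReads`).  Print, (3.46) p. 398: the bounded quantity is ‖h·(Tλ)‖ with supp h ⊂ Δ(y), against |h|·‖λ‖, supp λ ⊂ Δ(y′).  Typed:
`ev λ` evaluates λ on the model lattice `v`; supp λ ⊂ Δ(y′) ⇒ `ev λ` vanishes off the block of y′ (`off`) and ‖1_{Δ(y′)}ev λ‖₂ ≦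
‖λ‖ (`l2bound`, ‖λ‖ = `g.l2Norm λ` ≧ 0); |h| = `g.cutSup h` ≧ 0; and `K.l2 n U λ h` is BELOW every c ≧ 0 with
‖1_{Δ(y)}T(ev λ)‖₂·|h| ≦ c whenever supp h ⊂ Δ(y) (`obs` — ‖h·f‖₂ ≦ |h|‖1_{Δ(y)}f‖₂).  OURS (typing): a hypothesis schema on how a
model instantiates `l2Norm` ∕ `cutSup` ∕ `KernelFamily.l2`; nothing is asserted. [cite: Balaban1985BackgroundPropagators, (3.46) p.398] -/
structure L2Reads (K : B9.KernelFamily g B) (n : Fin 6) (U : B.Cfg) (bu : u → g.Site) (bv : v → g.Site)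
    (ev : g.Loc → v → ℝ) (T : (v → ℝ) →ₗ[ℝ] (u → ℝ)) : Prop where
  off : ∀ (lam : g.Loc) (y' : g.Site), g.suppIn lam y' → ∀ x', bv x' ≠ y' → ev lam x' = 0
  l2bound : ∀ (lam : g.Loc) (y' : g.Site), g.suppIn lam y' → bl2 (g := toB6 g R H) bv y' (ev lam) ≤ g.l2Norm lam
  l2norm_nonneg : ∀ lam : g.Loc, 0 ≤ g.l2Norm lam
  cutSup_nonneg : ∀ h : g.Cut, 0 ≤ g.cutSup h
  obs : ∀ (lam : g.Loc) (h : g.Cut) (y : g.Site) (c : ℝ), 0 ≤ c → g.cutIn h y →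
    bl2 (g := toB6 g R H) bu y (T (ev lam)) * g.cutSup h ≤ c → K.l2 n U lam h ≤ c

/-- **An L² block bound of the printed shape ⇒ the n-th (3.46) line AS TYPED**: if T has r1's block bound B·P(y)·e^{−δ′d(y,y′)}
between the block structures of `bv` (input) and `bu` (output), with B ≧ 0, P ≧ 0, and `K.l2 n` is co-read by T with
P = `B9.pref6 (L^jη) n`, then ∀ λ h y y′, supp h ⊂ Δ(y), supp λ ⊂ Δ(y′): K.l2 n U λ h ≦ B·pref6(L^jη)_n·|h|·e^{−δ′d(y,y′)}·‖λ‖.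
[cite: Balaban1985BackgroundPropagators, (3.46) p.398] -/
theorem l2line_of_blockBd {K : B9.KernelFamily g B} {n : Fin 6} {U : B.Cfg} {bu : u → g.Site} {bv : v → g.Site}
    {ev : g.Loc → v → ℝ} {T : (v → ℝ) →ₗ[ℝ] (u → ℝ)} (hR : L2Reads (R := R) (H := H) K n U bu bv ev T) {B' δ' : ℝ}
    (hB : 0 ≤ B') (hlen : ∀ y : g.Site, 0 ≤ g.len y)
    (hT : BlockBd (g := toB6 g R H) bv bu T
      (fun (y y' : g.Site) => B' * B9.pref6 (g.len y) n * Real.exp (-(δ' * g.dist y y')))) :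
    ∀ (lam : g.Loc) (h : g.Cut) (y y' : g.Site), g.cutIn h y → g.suppIn lam y' →
      K.l2 n U lam h ≤ B' * B9.pref6 (g.len y) n * g.cutSup h * Real.exp (-(δ' * g.dist y y')) * g.l2Norm lam := by
  intro lam h y y' hcut hsupp
  have hN : 0 ≤ B' * B9.pref6 (g.len y) n * Real.exp (-(δ' * g.dist y y')) :=
    mul_nonneg (mul_nonneg hB (B9FromB6.pref6_nonneg (hlen y) n)) (Real.exp_nonneg _)
  have hb := hT y' (ev lam) (hR.off lam y' hsupp) y
  have hc : 0 ≤ B' * B9.pref6 (g.len y) n * g.cutSup h * Real.exp (-(δ' * g.dist y y')) * g.l2Norm lam :=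
    mul_nonneg (mul_nonneg (mul_nonneg (mul_nonneg hB (B9FromB6.pref6_nonneg (hlen y) n)) (hR.cutSup_nonneg h))
      (Real.exp_nonneg _)) (hR.l2norm_nonneg lam)
  refine hR.obs lam h y _ hc hcut ?_
  calc bl2 (g := toB6 g R H) bu y (T (ev lam)) * g.cutSup h
      ≤ (B' * B9.pref6 (g.len y) n * Real.exp (-(δ' * g.dist y y')) * bl2 (g := toB6 g R H) bv y' (ev lam)) * g.cutSup h :=
        mul_le_mul_of_nonneg_right hb (hR.cutSup_nonneg h)
    _ ≤ (B' * B9.pref6 (g.len y) n * Real.exp (-(δ' * g.dist y y')) * g.l2Norm lam) * g.cutSup h :=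
        mul_le_mul_of_nonneg_right (mul_le_mul_of_nonneg_left (hR.l2bound lam y' hsupp) hN) (hR.cutSup_nonneg h)
    _ = B' * B9.pref6 (g.len y) n * g.cutSup h * Real.exp (-(δ' * g.dist y y')) * g.l2Norm lam := by ring

end Reading

/-! ## §4 The lines n = 0, 1, 2 of (3.46) at one member and one U -/

section OneMember

variable {g : B9.Geometry} [Fintype g.Site] {R : ℝ} {H : Prop} {B : B9.Backgrounds}
variable {X Y : Type} [Fintype X] [Fintype Y]

/-- pref6 at the first three entries is (L^jη)², L^jη, L^jη. [cite: Balaban1985BackgroundPropagators, (3.46) p.398] -/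
private theorem pref6_012 (t : ℝ) : B9.pref6 t 0 = t ^ 2 ∧ B9.pref6 t 1 = t ∧ B9.pref6 t 2 = t := by
  simp [B9.pref6]

/-- **THE L² LINES n = 0, 1, 2 OF (3.46) FOR A CO-READ KERNEL FAMILY from the sup majorants** (p. 409 ∕ p. 416: *"convergent in all
norms appearing in the inequalities (3.42)–(3.47)"*): from the sup majorants of A₀ = G(U), A₁ = ∇_UG(U), A₂ = G(U)∇\*_U with
constants (C, δ), the symmetry of A₀ and the transpose pair (A₁, A₂), the L² co-readings of `K.l2 0∕1∕2`, the member facts, the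
sign facts (d symmetric, L^jη > 0) and constants C·L₀ ≦ B₀, δ₀ ≦ (1 − α)δ: the three lines ‖hGJ‖, ‖h∇_UGJ‖, ‖hG∇\*_UJ‖ ≦
B₀[(L^jη)², L^jη, L^jη]|h|e^{−δ₀d(y,y′)}‖J‖ AS TYPED for K. [cite: Balaban1985BackgroundPropagators, (3.46) p.398 + (3.42) p.397 + Thm 3.7 p.409 + Thm 3.10 p.416] -/
theorem l2lines012_of_majorants {K : B9.KernelFamily g B} {U : B.Cfg} (blk : X → g.Site) (blkY : Y → g.Site)
    (ev : g.Loc → X → ℝ) (evY : g.Loc → Y → ℝ) {A0 : Module.End ℝ (X → ℝ)} {A1 : (X → ℝ) →ₗ[ℝ] (Y → ℝ)}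
    {A2 : (Y → ℝ) →ₗ[ℝ] (X → ℝ)} {d : ℕ} {C δ α L₀ B₀ δ₀ : ℝ}
    (h0 : HasMajorant (g := toB6 g R H) blk A0 (fun (a b : g.Site) => C * g.len a ^ 2 * Real.exp (-(δ * g.dist a b))))
    (h1 : HasMajorantHom (g := toB6 g R H) blk blkY A1 (fun (a b : g.Site) => C * g.len a * Real.exp (-(δ * g.dist a b))))
    (h2 : HasMajorantHom (g := toB6 g R H) blkY blk A2 (fun (a b : g.Site) => C * g.len a * Real.exp (-(δ * g.dist a b))))
    (hsym : IsTransposePair A0 A0) (htr : IsTransposePair A1 A2)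
    (hr0 : L2Reads (R := R) (H := H) K 0 U blk blk ev A0) (hr1 : L2Reads (R := R) (H := H) K 1 U blkY blk ev A1)
    (hr2 : L2Reads (R := R) (H := H) K 2 U blk blkY evY A2)
    (hF : Facts347 g R H d δ α L₀) (hsymm : ∀ y y' : g.Site, g.dist y y' = g.dist y' y)
    (hdist : ∀ a b : g.Site, 0 ≤ g.dist a b) (hlen : ∀ y : g.Site, 0 < g.len y)
    (hC : 0 ≤ C) (hCB : C * L₀ ≤ B₀) (hδ : δ₀ ≤ (1 - α) * δ) :
    (∀ (lam : g.Loc) (h : g.Cut) (y y' : g.Site), g.cutIn h y → g.suppIn lam y' →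
        K.l2 0 U lam h ≤ B₀ * B9.pref6 (g.len y) 0 * g.cutSup h * Real.exp (-(δ₀ * g.dist y y')) * g.l2Norm lam) ∧
      (∀ (lam : g.Loc) (h : g.Cut) (y y' : g.Site), g.cutIn h y → g.suppIn lam y' →
        K.l2 1 U lam h ≤ B₀ * B9.pref6 (g.len y) 1 * g.cutSup h * Real.exp (-(δ₀ * g.dist y y')) * g.l2Norm lam) ∧
      (∀ (lam : g.Loc) (h : g.Cut) (y y' : g.Site), g.cutIn h y → g.suppIn lam y' →
        K.l2 2 U lam h ≤ B₀ * B9.pref6 (g.len y) 2 * g.cutSup h * Real.exp (-(δ₀ * g.dist y y')) * g.l2Norm lam) := by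
  have hlen0 : ∀ y : g.Site, 0 ≤ g.len y := fun y => (hlen y).le
  have hL₀ : 0 ≤ L₀ := le_trans (le_trans zero_le_one hF.one_le_L) hF.L_le
  have hCL : 0 ≤ C * L₀ := mul_nonneg hC hL₀
  have hB₀ : 0 ≤ B₀ := hCL.trans hCB
  -- the three block bounds at (C L₀, (1−α)δ), then merged to (B₀, δ₀)
  have hexp : ∀ y y' : g.Site, Real.exp (-((1 - α) * δ * g.dist y y')) ≤ Real.exp (-(δ₀ * g.dist y y')) := fun y y' =>
    Real.exp_le_exp.2 (neg_le_neg (mul_le_mul_of_nonneg_right hδ (hdist y y')))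
  have hmono : ∀ (P : g.Site → ℝ), (∀ y, 0 ≤ P y) → ∀ y y' : g.Site,
      C * L₀ * P y * Real.exp (-((1 - α) * δ * g.dist y y')) ≤ B₀ * P y * Real.exp (-(δ₀ * g.dist y y')) :=
    fun P hP y y' => mul_le_mul (mul_le_mul_of_nonneg_right hCB (hP y)) (hexp y y') (Real.exp_nonneg _)
      (mul_nonneg hB₀ (hP y))
  have hb0 : BlockBd (g := toB6 g R H) blk blk A0
      (fun (y y' : g.Site) => B₀ * B9.pref6 (g.len y) 0 * Real.exp (-(δ₀ * g.dist y y'))) := by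
    refine (blockBd_entry0 hF hC hsymm hlen blk h0 hsym).mono fun y y' => ?_
    rw [(pref6_012 (g.len y)).1]
    exact hmono (fun y => g.len y ^ 2) (fun y => sq_nonneg _) y y'
  have hb1 : BlockBd (g := toB6 g R H) blk blkY A1
      (fun (y y' : g.Site) => B₀ * B9.pref6 (g.len y) 1 * Real.exp (-(δ₀ * g.dist y y'))) := by
    refine (blockBd_entry1 hF hC hsymm hlen blk blkY h1 h2 htr).mono fun y y' => ?_
    rw [(pref6_012 (g.len y)).2.1]
    exact hmono (fun y => g.len y) hlen0 y y'
  have hb2 : BlockBd (g := toB6 g R H) blkY blk A2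
      (fun (y y' : g.Site) => B₀ * B9.pref6 (g.len y) 2 * Real.exp (-(δ₀ * g.dist y y'))) := by
    refine (blockBd_entry2 hF hC hsymm hlen blk blkY h1 h2 htr).mono fun y y' => ?_
    rw [(pref6_012 (g.len y)).2.2]
    exact hmono (fun y => g.len y) hlen0 y y'
  exact ⟨l2line_of_blockBd hr0 hB₀ hlen0 hb0, l2line_of_blockBd hr1 hB₀ hlen0 hb1, l2line_of_blockBd hr2 hB₀ hlen0 hb2⟩

end OneMember

/-! ## §5 The all-blocks leaves with the L² lines n = 0, 1, 2 proved -/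

section AllPins

variable {I : Type} {c35 : ℝ} {geo : I → B9.Geometry} {bg : I → B9.Backgrounds}
variable [∀ i, Fintype (geo i).Site] [∀ i, DecidableEq (geo i).Site]

/-- Assembly of the six (3.46) lines from the three proved ones (n = 0, 1, 2) and the three displayed ones (n = 3, 4, 5).
[cite: Balaban1985BackgroundPropagators, (3.46) p.398] -/
private theorem l2lines_of_split {g : B9.Geometry} {B : B9.Backgrounds} {K : B9.KernelFamily g B} {U : B.Cfg} {B₀ δ₀ : ℝ}
    (h012 : (∀ (lam : g.Loc) (h : g.Cut) (y y' : g.Site), g.cutIn h y → g.suppIn lam y' →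
        K.l2 0 U lam h ≤ B₀ * B9.pref6 (g.len y) 0 * g.cutSup h * Real.exp (-(δ₀ * g.dist y y')) * g.l2Norm lam) ∧
      (∀ (lam : g.Loc) (h : g.Cut) (y y' : g.Site), g.cutIn h y → g.suppIn lam y' →
        K.l2 1 U lam h ≤ B₀ * B9.pref6 (g.len y) 1 * g.cutSup h * Real.exp (-(δ₀ * g.dist y y')) * g.l2Norm lam) ∧
      (∀ (lam : g.Loc) (h : g.Cut) (y y' : g.Site), g.cutIn h y → g.suppIn lam y' →
        K.l2 2 U lam h ≤ B₀ * B9.pref6 (g.len y) 2 * g.cutSup h * Real.exp (-(δ₀ * g.dist y y')) * g.l2Norm lam))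
    (h345 : ∀ (n : Fin 6), 3 ≤ n.val → ∀ (lam : g.Loc) (h : g.Cut) (y y' : g.Site), g.cutIn h y → g.suppIn lam y' →
        K.l2 n U lam h ≤ B₀ * B9.pref6 (g.len y) n * g.cutSup h * Real.exp (-(δ₀ * g.dist y y')) * g.l2Norm lam) :
    ∀ (n : Fin 6) (lam : g.Loc) (h : g.Cut) (y y' : g.Site), g.cutIn h y → g.suppIn lam y' →
      K.l2 n U lam h ≤ B₀ * B9.pref6 (g.len y) n * g.cutSup h * Real.exp (-(δ₀ * g.dist y y')) * g.l2Norm lam := by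
  obtain ⟨h0, h1, h2⟩ := h012
  intro n
  fin_cases n
  · exact h0
  · exact h1
  · exact h2
  · exact h345 3 (by decide)
  · exact h345 4 (by decide)
  · exact h345 5 (by decide)

/-- ★ **THEOREM 3.10 AT THE ALL-BLOCKS PIN, the L² lines n = 0, 1, 2 PROVED** (the sibling's `thm310Printed_allPin` with its
displayed (3.46) residual shrunk to the lines n = 3, 4, 5).  Extra inputs: the symmetry of G(U) and the transpose pair
(∇_UG(U), G(U)∇\*_U) (`IsTransposePair`, hypotheses on the letters; p. 391 ∕ Theorem 3.11), the L² co-readings `L2Reads` of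
`K.l2 0∕1∕2`, d symmetric, and the constants C·L₀ ≦ B₀, δ₀ ≦ (1 − α)δ.  Nothing of print asserted; NOT a node discharge.
[cite: Balaban1985BackgroundPropagators, Thm 3.10 pp.415–416 + (3.42)–(3.47) pp.397–398 + p.391; Balaban1984PropagatorsII, Lemma 2.1 p.234] -/
theorem thm310Printed_allPin_schur {X Y ι A : I → Type} [∀ i, Fintype (X i)] [∀ i, Fintype (Y i)]
    {𝔬 : ∀ i, Ops310 (geo i) (bg i) (X i) (Y i) (ι i) (A i)}
    {rd : ∀ i, WalkReading310 (geo i) (bg i) (X i) (ι i) (A i)} {R : I → ℝ} {H : I → Prop} {C δ : ℝ}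
    (K : ∀ i, B9.KernelFamily (geo i) (bg i)) (ev : ∀ i, (geo i).Loc → X i → ℝ) (evY : ∀ i, (geo i).Loc → Y i → ℝ)
    {d : ℕ} {α L₀ B₀ δ₀ Mg Mr ar : ℝ} {Bβ Bε : ℝ → ℝ} {Bεβ : ℝ → ℝ → ℝ}
    (h310 : B9.Thm310Printed c35 geo bg (fun i => W310OfOps (𝔬 i) (rd i) (Conv3107 (𝔬 i) (R i) (H i) C δ)))
    (hco0 : ∀ i U, CoRealizes (K i) 0 U (𝔬 i).blk (𝔬 i).blk (ev i) ((𝔬 i).G U))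
    (hco1 : ∀ i U, CoRealizes (K i) 1 U (𝔬 i).blkY (𝔬 i).blk (ev i) ((𝔬 i).D U ∘ₗ (𝔬 i).G U))
    (hco2 : ∀ i U, CoRealizes (K i) 2 U (𝔬 i).blk (𝔬 i).blkY (evY i) ((𝔬 i).G U ∘ₗ (𝔬 i).Dstar U))
    (hco3 : ∀ i U, CoRealizes (K i) 3 U (𝔬 i).blk (𝔬 i).blk (ev i) ((𝔬 i).Lap U ∘ₗ (𝔬 i).G U))
    (hgl0 : ∀ i U, GlobReads (K i) 0 U (𝔬 i).blk (𝔬 i).blk (ev i) ((𝔬 i).G U))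
    (hgl1 : ∀ i U, GlobReads (K i) 1 U (𝔬 i).blkY (𝔬 i).blk (ev i) ((𝔬 i).D U ∘ₗ (𝔬 i).G U))
    (hgl2 : ∀ i U, GlobReads (K i) 2 U (𝔬 i).blk (𝔬 i).blkY (evY i) ((𝔬 i).G U ∘ₗ (𝔬 i).Dstar U))
    (hgl3 : ∀ i U, GlobReads (K i) 3 U (𝔬 i).blk (𝔬 i).blk (ev i) ((𝔬 i).Lap U ∘ₗ (𝔬 i).G U))
    (hl0 : ∀ i U, L2Reads (R := R i) (H := H i) (K i) 0 U (𝔬 i).blk (𝔬 i).blk (ev i) ((𝔬 i).G U))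
    (hl1 : ∀ i U, L2Reads (R := R i) (H := H i) (K i) 1 U (𝔬 i).blkY (𝔬 i).blk (ev i) ((𝔬 i).D U ∘ₗ (𝔬 i).G U))
    (hl2 : ∀ i U, L2Reads (R := R i) (H := H i) (K i) 2 U (𝔬 i).blk (𝔬 i).blkY (evY i) ((𝔬 i).G U ∘ₗ (𝔬 i).Dstar U))
    (hsym : ∀ i U, IsTransposePair ((𝔬 i).G U) ((𝔬 i).G U))
    (htr : ∀ i U, IsTransposePair ((𝔬 i).D U ∘ₗ (𝔬 i).G U) ((𝔬 i).G U ∘ₗ (𝔬 i).Dstar U))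
    (hfacts : ∀ i, Mg ≤ (geo i).M → Facts347 (geo i) (R i) (H i) d δ α L₀)
    (hdsymm : ∀ i (a b : (geo i).Site), (geo i).dist a b = (geo i).dist b a)
    (hdist : ∀ i (a b : (geo i).Site), 0 ≤ (geo i).dist a b) (hlen : ∀ i (y : (geo i).Site), 0 < (geo i).len y)
    (hC : 0 ≤ C) (hCB : C ≤ B₀) (hCL : C * L₀ ≤ B₀) (hδ₀ : δ₀ ≤ (1 - α) * δ) (hα : 0 ≤ α * δ)
    (hCg : C * B6.c1 d δ (1 - α) * L₀ ^ (4 : ℝ) ≤ B₀) (har : 0 < ar)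
    (hrest : ∀ i, Mr ≤ (geo i).M → ∀ α₀ : ℝ, 0 < α₀ → (geo i).M * α₀ ≤ ar → ∀ U : (bg i).Cfg, (bg i).Reg335 c35 α₀ U →
      B9.Ineq343_345 (K i) Bβ Bε Bεβ δ₀ U ∧
        ∀ (n : Fin 6), 3 ≤ n.val → ∀ (lam : (geo i).Loc) (h : (geo i).Cut) (y y' : (geo i).Site), (geo i).cutIn h y →
          (geo i).suppIn lam y' →
          (K i).l2 n U lam h ≤ B₀ * B9.pref6 ((geo i).len y) n * (geo i).cutSup h * Real.exp (-(δ₀ * (geo i).dist y y')) *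
            (geo i).l2Norm lam) :
    B9.Thm310Printed c35 geo bg
      (fun i => W310OfOps (𝔬 i) (rd i) (ConvAll3107 (𝔬 i) (R i) (H i) C δ (K i) B₀ δ₀ Bβ Bε Bεβ)) := by
  have hδ₀' : δ₀ ≤ δ := hδ₀.trans (by nlinarith [hα])
  refine thm310Printed_W310OfOps_strengthen h310 (max Mg Mr) ar har fun i hM α₀ hα₀ hMa U hU hconv => ?_
  have hMg : Mg ≤ (geo i).M := le_trans (le_max_left _ _) hM
  have hMr : Mr ≤ (geo i).M := le_trans (le_max_right _ _) hM
  obtain ⟨h343, h345⟩ := hrest i hMr α₀ hα₀ hMa U hU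
  obtain ⟨h0, h1, h2, h3⟩ := hconv
  have h012 := l2lines012_of_majorants (𝔬 i).blk (𝔬 i).blkY (ev i) (evY i) h0 h1 h2 (hsym i U) (htr i U) (hl0 i U) (hl1 i U)
    (hl2 i U) (hfacts i hMg) (hdsymm i) (hdist i) (hlen i) hC hCL hδ₀
  exact ⟨⟨h0, h1, h2, h3⟩, allIneqs_of_majorants (𝔬 i).blk (𝔬 i).blkY (ev i) (evY i) h0 h1 h2 h3 (hco0 i U) (hco1 i U)
    (hco2 i U) (hco3 i U) (hgl0 i U) (hgl1 i U) (hgl2 i U) (hgl3 i U) (hfacts i hMg) (hdist i) (hlen i) hC hCB hδ₀' hCg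
    h343 (l2lines_of_split h012 h345)⟩

omit [∀ i, DecidableEq (geo i).Site] in
/-- ★ **THEOREM 3.7 AT THE ALL-BLOCKS PIN, the L² lines n = 0, 1, 2 PROVED** (the sibling's `thm37Printed_allPin` with its displayed
(3.46) residual shrunk to the lines n = 3, 4, 5).  Extra inputs: the symmetry of G′(U) and the transpose pair (∇_UG′(U), G′(U)∇\*_U),
the L² co-readings, d symmetric, constants C·L₀ ≦ B₀, δ₀ ≦ (1 − α)δ.  Nothing of print asserted; NOT a node discharge.
[cite: Balaban1985BackgroundPropagators, Thm 3.7 p.409 + Thm 3.7 ⇒ Thm 3.1 p.410 + (3.42)–(3.47) pp.397–398 + p.391; Balaban1984PropagatorsII, Lemma 2.1 p.234] -/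
theorem thm37Printed_allPin_schur {X Y ι : I → Type} [∀ i, Fintype (X i)] [∀ i, Fintype (Y i)]
    {𝔴 : ∀ i, B9.RWExpansion (geo i) (bg i)} {𝔬 : ∀ i, Ops (geo i) (bg i) (X i) (Y i) (ι i)}
    {R : I → ℝ} {H : I → Prop} {C δ : ℝ}
    (K : ∀ i, B9.KernelFamily (geo i) (bg i)) (ev : ∀ i, (geo i).Loc → X i → ℝ) (evY : ∀ i, (geo i).Loc → Y i → ℝ)
    {d : ℕ} {α L₀ B₀ δ₀ Mg Mr ar : ℝ} {Bβ Bε : ℝ → ℝ} {Bεβ : ℝ → ℝ → ℝ}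
    (h37 : B9.Thm37Printed c35 geo bg (fun i => E37OfOps (𝔴 i) (𝔬 i) (R i) (H i) C δ))
    (hco0 : ∀ i U, CoRealizes (K i) 0 U (𝔬 i).blk (𝔬 i).blk (ev i) ((𝔬 i).Gp U))
    (hco1 : ∀ i U, CoRealizes (K i) 1 U (𝔬 i).blkY (𝔬 i).blk (ev i) ((𝔬 i).D U ∘ₗ (𝔬 i).Gp U))
    (hco2 : ∀ i U, CoRealizes (K i) 2 U (𝔬 i).blk (𝔬 i).blkY (evY i) ((𝔬 i).Gp U ∘ₗ (𝔬 i).Dstar U))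
    (hco3 : ∀ i U, CoRealizes (K i) 3 U (𝔬 i).blk (𝔬 i).blk (ev i) ((𝔬 i).Lap U ∘ₗ (𝔬 i).Gp U))
    (hgl0 : ∀ i U, GlobReads (K i) 0 U (𝔬 i).blk (𝔬 i).blk (ev i) ((𝔬 i).Gp U))
    (hgl1 : ∀ i U, GlobReads (K i) 1 U (𝔬 i).blkY (𝔬 i).blk (ev i) ((𝔬 i).D U ∘ₗ (𝔬 i).Gp U))
    (hgl2 : ∀ i U, GlobReads (K i) 2 U (𝔬 i).blk (𝔬 i).blkY (evY i) ((𝔬 i).Gp U ∘ₗ (𝔬 i).Dstar U))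
    (hgl3 : ∀ i U, GlobReads (K i) 3 U (𝔬 i).blk (𝔬 i).blk (ev i) ((𝔬 i).Lap U ∘ₗ (𝔬 i).Gp U))
    (hl0 : ∀ i U, L2Reads (R := R i) (H := H i) (K i) 0 U (𝔬 i).blk (𝔬 i).blk (ev i) ((𝔬 i).Gp U))
    (hl1 : ∀ i U, L2Reads (R := R i) (H := H i) (K i) 1 U (𝔬 i).blkY (𝔬 i).blk (ev i) ((𝔬 i).D U ∘ₗ (𝔬 i).Gp U))
    (hl2 : ∀ i U, L2Reads (R := R i) (H := H i) (K i) 2 U (𝔬 i).blk (𝔬 i).blkY (evY i) ((𝔬 i).Gp U ∘ₗ (𝔬 i).Dstar U))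
    (hsym : ∀ i U, IsTransposePair ((𝔬 i).Gp U) ((𝔬 i).Gp U))
    (htr : ∀ i U, IsTransposePair ((𝔬 i).D U ∘ₗ (𝔬 i).Gp U) ((𝔬 i).Gp U ∘ₗ (𝔬 i).Dstar U))
    (hfacts : ∀ i, Mg ≤ (geo i).M → Facts347 (geo i) (R i) (H i) d δ α L₀)
    (hdsymm : ∀ i (a b : (geo i).Site), (geo i).dist a b = (geo i).dist b a)
    (hdist : ∀ i (a b : (geo i).Site), 0 ≤ (geo i).dist a b) (hlen : ∀ i (y : (geo i).Site), 0 < (geo i).len y)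
    (hC : 0 ≤ C) (hCB : C ≤ B₀) (hCL : C * L₀ ≤ B₀) (hδ₀ : δ₀ ≤ (1 - α) * δ) (hα : 0 ≤ α * δ)
    (hCg : C * B6.c1 d δ (1 - α) * L₀ ^ (4 : ℝ) ≤ B₀) (har : 0 < ar)
    (hrest : ∀ i, Mr ≤ (geo i).M → ∀ α₀ : ℝ, 0 < α₀ → (geo i).M * α₀ ≤ ar → ∀ U : (bg i).Cfg, (bg i).Reg335 c35 α₀ U →
      B9.Ineq343_345 (K i) Bβ Bε Bεβ δ₀ U ∧
        ∀ (n : Fin 6), 3 ≤ n.val → ∀ (lam : (geo i).Loc) (h : (geo i).Cut) (y y' : (geo i).Site), (geo i).cutIn h y →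
          (geo i).suppIn lam y' →
          (K i).l2 n U lam h ≤ B₀ * B9.pref6 ((geo i).len y) n * (geo i).cutSup h * Real.exp (-(δ₀ * (geo i).dist y y')) *
            (geo i).l2Norm lam) :
    B9.Thm37Printed c35 geo bg (fun i => E37AllOfOps (𝔴 i) (𝔬 i) (R i) (H i) C δ (K i) B₀ δ₀ Bβ Bε Bεβ) := by
  have hδ₀' : δ₀ ≤ δ := hδ₀.trans (by nlinarith [hα])
  refine thm37Printed_strengthen h37 (max Mg Mr) ar har fun i hM α₀ hα₀ hMa U hU hconv => ?_
  have hMg : Mg ≤ (geo i).M := le_trans (le_max_left _ _) hM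
  have hMr : Mr ≤ (geo i).M := le_trans (le_max_right _ _) hM
  obtain ⟨h343, h345⟩ := hrest i hMr α₀ hα₀ hMa U hU
  obtain ⟨h0, h1, h2, h3⟩ := hconv
  have h012 := l2lines012_of_majorants (𝔬 i).blk (𝔬 i).blkY (ev i) (evY i) h0 h1 h2 (hsym i U) (htr i U) (hl0 i U) (hl1 i U)
    (hl2 i U) (hfacts i hMg) (hdsymm i) (hdist i) (hlen i) hC hCL hδ₀
  exact ⟨⟨h0, h1, h2, h3⟩, allIneqs_of_majorants (𝔬 i).blk (𝔬 i).blkY (ev i) (evY i) h0 h1 h2 h3 (hco0 i U) (hco1 i U)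
    (hco2 i U) (hco3 i U) (hgl0 i U) (hgl1 i U) (hgl2 i U) (hgl3 i U) (hfacts i hMg) (hdist i) (hlen i) hC hCB hδ₀' hCg
    h343 (l2lines_of_split h012 h345)⟩

end AllPins

end

end Literature.MathematicalPhysics.QuantumFieldTheory.Balaban1983to89.B9RWSums346Schur
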